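import Literature.NumberTheory.EllipticCurves.PerrinRiouCMSigma
import Literature.NumberTheory.EllipticCurves.CanonicalPAdicHeightThetaFormalProofs
import Literature.RingTheory.FormalGroups.FunctionalEquationIntegrality
import HarnessLib

/-!
# Route `CyclotomicUntwist`, crux K1 `PSRankOneLowerHalfAtThree` (stmt-BirchSwinnertonDyer-21580):
# the σ-LINE FAMILY LAW, formal layer — the one-parameter family `formalSigma V c` of normalised odd
# solutions of the Mazur–Tate sigma equation is an `exp(ε·log²)`-torsor, every member satisfies the
# formal theta relation, and the constant is read on the `t³`-coefficient

Cell `pub/bsd-wall` (D-0145 line `route-BirchSwinnertonDyer-CyclotomicUntwist`), seat `bsd-line-cycu-p1`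
g4 (K1 base). THEOREMS ONLY (no definition, no named fact, no `sorry`); helper `--supports` K1 =
stmt-BirchSwinnertonDyer-21580. BSD is not proved by this file and nothing here is evidence for or
against K1/K2.

WHY (the route's D5 / DICH interface). On the principal-series rows the `ψ`-line height of the route
(D2 `WeierstrassCurve.PSLineHeightData`, intended instance Benois's `h^{spl}_{V,D_ψ}`) is — by the numerical
test of seat cycu-p3 g4 (`Cruxes/PSRankOneLowerHalfAtThree/GZ3-NUMERIC-TEST-v2.md`, five rank-one PS
classes, `X = −2 + O(3⁶)`) — the SIGMA HEIGHT built from the member `σ_{c_ψ}` of the one-parameter family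
of formal sigma functions of the minimal model at `3`, `c_ψ ∈ ℚ₃(ζ₃)` the parameter of the `φ₀`-eigenline
(proposed pin D5 `defn-PSCanonicalSelmerHeight`); the census cell types the same family at an additive
`p ≥ 5` (`Summit.BirchSwinnertonDyer.Rank1Residual.Additive.CensusX42.sigmaHeight`, "Bernardi quadraticity of
`σ_c`-heights at an additive prime is not a tree theorem"). The tree's family is
`WeierstrassCurve.formalSigma V c` (`PerrinRiouCMSigma.lean`: THE normalised odd solution `σ = t + ⋯` of
`x + c = −D(Dσ/σ)`, for EVERY `c ∈ ℚ_p`; Perrin-Riou's `σ_v` is `formalSigma V (b₂/12 + s₂)`, Mazur–Tate's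
`σ_p` is `formalSigma V c_p`). This file proves the structural facts about the FAMILY that every
`σ_c`-height statement (D5, the Perrin-Riou dichotomy DICH of the separated K1 ∧ K2 glue
`psRankOne_halves_of_separated`, the census's `IsTwistSigmaHeight`) rests on:

* §1 `exp(ε·log_V²)`: constant term `1`, linear term `0`, quadratic term `ε`; `exp(ε log²)·exp(δ log²)
  = exp((ε+δ) log²)`; it is a unit with inverse `exp(−ε log²)`.
* §2 **THE SHIFT LAW** `formalSigma_eq_formalSigma_mul_exp`:
  `formalSigma V c′ = formalSigma V c · exp(((c − c′)/2)·log_V²)` for all `c, c′` (the family is a torsor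
  under the one-parameter group `ε ↦ exp(ε log²)`; Mazur–Tate 1991 §3 / Mazur–Stein–Tate 2006 §3.1 "the
  constant of integration"); the same for ANY two normalised odd solutions
  (`eq_mul_exp_of_satisfiesSigmaODE`), and in Perrin-Riou's parameter `s₂` (`perrinRiouSigma_eq_mul_exp`).
* §3 **LOW-ORDER COEFFICIENTS**: `[t²]σ_c = a₁/2` for every `c` (oddness), and
  `[t³]σ_{c′} − [t³]σ_c = (c − c′)/2` — the constant is READ on the `t³`-coefficient
  (`formalSigma_injective`: distinct constants give distinct sigma functions; the census's
  "`log σ_c = log z + (b₂/24 − c/2)z² + ⋯`").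
* §4 **c-INDEPENDENCE OF THE THETA RELATION**: for `V` with `p`-integral equation and `Δ ≠ 0`, EVERY
  member satisfies Blakestad–Grant's formal theta relation `σ(u +_F v)σ(u −_F v)u²v² =
  (u²X(v) − v²X(u))σ(u)²σ(v)²` (`thetaLHS = thetaRHS`, the tree's `thetaLHS_eq_thetaRHS`) — the formal
  reason why every `σ_c`-height is a quadratic form with the SAME parallelogram law, the `c`-dependence
  being carried entirely by the factor `exp(((c−c′)/2) log²)`, i.e. by `log_ω(P)²` at the level of values
  (value layer: the sequel file `CyclotomicUntwistSigmaLineFamilyValues.lean`).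
* §5 **THE LOG-DERIVATIVE LAW** `D σ_{c′} · σ_c − σ_{c′} · D σ_c = (c − c′)·log_V·σ_c·σ_{c′}`
  (`D = d/ω`; i.e. `D log(σ_{c′}/σ_c) = (c − c′) log_V`).

References: B. Mazur, J. Tate, *The p-adic sigma function*, Duke Math. J. 62 (1991), §3 (proof of
Thm. 3.1: the one-parameter family of formal solutions); B. Mazur, W. Stein, J. Tate, Doc. Math. Extra
Vol. (2006), Thm. 1.3, §3.1; D. Bernardi, *Hauteur p-adique sur les courbes elliptiques*, Sém. Théorie
des Nombres Paris 1979–80, Progr. Math. 12 (the family `σ_α`); B. Perrin-Riou, Mém. SMF 17 (1984) Ch. III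
§1.2 (`σ_v`, parameter `s₂`); C. Blakestad, D. Grant, J. Number Theory 249 (2023), Prop. 14.
[cite: MazurSteinTate2006, Thm. 1.3] [cite: MazurTate1991, Thm. 3.1] [cite: BlakestadGrant2023, Prop. 14]
[cite: Perrinriou1984, Ch. III §1.2 Lemme 2]
-/

set_option autoImplicit false
-- single-conjunct summit: `Summit.BirchSwinnertonDyer.BirchSwinnertonDyer.…` repeats the name by design
set_option linter.dupNamespace false

noncomputable section

open scoped Classical

open PowerSeries WeierstrassCurve Literature.RingTheory.FormalGroups

namespace Summit.BirchSwinnertonDyer.BirchSwinnertonDyer.Theorems.PSSigmaLineFamily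

variable {p : ℕ} [Fact p.Prime] (V : WeierstrassCurve ℚ_[p])

/-! ### §1 The one-parameter group `ε ↦ exp(ε·log_V²)` -/

/-- `ε·log_V²` has no constant term. [folklore] -/
theorem constantCoeff_C_mul_formalLog_sq (ε : ℚ_[p]) :
    constantCoeff (C ε * V.formalLog ^ 2) = 0 := by
  rw [map_mul, map_pow, constantCoeff_formalLog, zero_pow two_ne_zero, mul_zero]

/-- `ε·log_V²` has no linear term (`log_V = t + ⋯`). [folklore] -/
theorem coeff_one_C_mul_formalLog_sq (ε : ℚ_[p]) : coeff 1 (C ε * V.formalLog ^ 2) = 0 := by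
  rw [coeff_C_mul, sq, coeff_mul, Finset.Nat.sum_antidiagonal_eq_sum_range_succ_mk]
  simp [Finset.sum_range_succ]

/-- `[t²](ε·log_V²) = ε` (`log_V = t + ⋯`). [folklore] -/
theorem coeff_two_C_mul_formalLog_sq (ε : ℚ_[p]) : coeff 2 (C ε * V.formalLog ^ 2) = ε := by
  rw [coeff_C_mul, sq, coeff_mul, Finset.Nat.sum_antidiagonal_eq_sum_range_succ_mk]
  simp [Finset.sum_range_succ]

/-- `exp(ε·log_V²)` has constant term `1`. [folklore] -/
theorem constantCoeff_exp_formalLog_sq (ε : ℚ_[p]) :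
    constantCoeff ((exp ℚ_[p]).subst (C ε * V.formalLog ^ 2)) = 1 :=
  constantCoeff_exp_subst (constantCoeff_C_mul_formalLog_sq V ε)

/-- `exp(ε·log_V²)` has no linear term. [folklore] -/
theorem coeff_one_exp_formalLog_sq (ε : ℚ_[p]) :
    coeff 1 ((exp ℚ_[p]).subst (C ε * V.formalLog ^ 2)) = 0 := by
  rw [coeff_one_exp_subst (constantCoeff_C_mul_formalLog_sq V ε), coeff_one_C_mul_formalLog_sq]

/-- For `g` with `g(0) = 0` and `[t¹]g = 0`: `[t²]exp(g) = [t²]g` (the powers `g^d`, `d ≥ 2`, have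
order `≥ 4`). [folklore] -/
theorem coeff_two_exp_subst_of_coeff_one_eq_zero {g : ℚ_[p]⟦X⟧} (hg0 : constantCoeff g = 0)
    (hg1 : coeff 1 g = 0) : coeff 2 ((exp ℚ_[p]).subst g) = coeff 2 g := by
  have hXg : X ^ 2 ∣ g := by
    refine (X_pow_dvd_iff).mpr fun m hm => ?_
    interval_cases m
    · rwa [coeff_zero_eq_constantCoeff]
    · exact hg1
  rw [coeff_subst' (HasSubst.of_constantCoeff_zero' hg0), finsum_eq_single _ 1]
  · rw [pow_one, coeff_exp, Nat.factorial_one, Nat.cast_one, div_one, map_one, one_smul]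
  · intro d hd
    rcases Nat.lt_or_gt_of_ne hd with h | h
    · rw [Nat.lt_one_iff.mp h, pow_zero, coeff_one, if_neg two_ne_zero, smul_zero]
    · have hdvd : X ^ (2 * d) ∣ g ^ d := by rw [pow_mul]; exact pow_dvd_pow_of_dvd hXg d
      obtain ⟨q, hq⟩ := hdvd
      have h0 : coeff 2 (g ^ d) = 0 := by
        rw [hq, coeff_X_pow_mul', if_neg (by omega)]
      rw [h0, smul_zero]

/-- `[t²]exp(ε·log_V²) = ε`. [folklore] -/
theorem coeff_two_exp_formalLog_sq (ε : ℚ_[p]) :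
    coeff 2 ((exp ℚ_[p]).subst (C ε * V.formalLog ^ 2)) = ε := by
  rw [coeff_two_exp_subst_of_coeff_one_eq_zero (constantCoeff_C_mul_formalLog_sq V ε)
    (coeff_one_C_mul_formalLog_sq V ε), coeff_two_C_mul_formalLog_sq]

/-- **One-parameter group**: `exp(ε log_V²)·exp(δ log_V²) = exp((ε + δ) log_V²)`. [folklore] -/
theorem exp_formalLog_sq_mul (ε δ : ℚ_[p]) :
    (exp ℚ_[p]).subst (C ε * V.formalLog ^ 2) * (exp ℚ_[p]).subst (C δ * V.formalLog ^ 2) =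
      (exp ℚ_[p]).subst (C (ε + δ) * V.formalLog ^ 2) := by
  rw [← exp_subst_add (constantCoeff_C_mul_formalLog_sq V ε) (constantCoeff_C_mul_formalLog_sq V δ),
    map_add, add_mul]

/-- `exp(0·log_V²) = 1`. [folklore] -/
theorem exp_formalLog_sq_zero : (exp ℚ_[p]).subst (C (0 : ℚ_[p]) * V.formalLog ^ 2) = 1 := by
  rw [map_zero, zero_mul, exp_subst_zero]

/-- `exp(ε log_V²)·exp(−ε log_V²) = 1`. [folklore] -/
theorem exp_formalLog_sq_mul_neg (ε : ℚ_[p]) :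
    (exp ℚ_[p]).subst (C ε * V.formalLog ^ 2) * (exp ℚ_[p]).subst (C (-ε) * V.formalLog ^ 2) = 1 := by
  rw [exp_formalLog_sq_mul, add_neg_cancel, exp_formalLog_sq_zero]

/-- `exp(ε log_V²)` is a unit of `ℚ_p⟦t⟧`. [folklore] -/
theorem isUnit_exp_formalLog_sq (ε : ℚ_[p]) : IsUnit ((exp ℚ_[p]).subst (C ε * V.formalLog ^ 2)) :=
  isUnit_iff_exists_inv.mpr ⟨_, exp_formalLog_sq_mul_neg V ε⟩

/-- `exp(ε log_V²) ≠ 0`. [folklore] -/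
theorem exp_formalLog_sq_ne_zero (ε : ℚ_[p]) : (exp ℚ_[p]).subst (C ε * V.formalLog ^ 2) ≠ 0 :=
  (isUnit_exp_formalLog_sq V ε).ne_zero

/-- `exp(ε log_V²) = 1` iff `ε = 0` (read the `t²`-coefficient). [folklore] -/
theorem exp_formalLog_sq_eq_one_iff (ε : ℚ_[p]) :
    (exp ℚ_[p]).subst (C ε * V.formalLog ^ 2) = 1 ↔ ε = 0 := by
  refine ⟨fun h => ?_, fun h => by rw [h, exp_formalLog_sq_zero]⟩
  have h2 := congrArg (coeff 2) h
  rwa [coeff_two_exp_formalLog_sq, coeff_one, if_neg two_ne_zero] at h2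

/-! ### §2 The shift law: the family `formalSigma V c` is an `exp(ε·log²)`-torsor -/

/-- The defining properties of `formalSigma V c`, unpacked: no constant term. [cite: MazurSteinTate2006, Thm. 1.3] -/
theorem constantCoeff_formalSigma (c : ℚ_[p]) : constantCoeff (V.formalSigma c) = 0 :=
  (V.formalSigma_spec c).1

/-- `formalSigma V c = t + ⋯`. [cite: MazurSteinTate2006, Thm. 1.3] -/
theorem coeff_one_formalSigma (c : ℚ_[p]) : coeff 1 (V.formalSigma c) = 1 :=
  (V.formalSigma_spec c).2.1

/-- `formalSigma V c` is odd: `σ(i(t)) = −σ(t)`. [cite: MazurSteinTate2006, Thm. 1.3] -/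
theorem isFormallyOdd_formalSigma (c : ℚ_[p]) : V.IsFormallyOdd (V.formalSigma c) :=
  (V.formalSigma_spec c).2.2.1

/-- `formalSigma V c` satisfies the sigma equation with constant `c`. [cite: MazurSteinTate2006, Thm. 1.3] -/
theorem satisfiesSigmaODE_formalSigma (c : ℚ_[p]) : V.SatisfiesSigmaODE (V.formalSigma c) c :=
  (V.formalSigma_spec c).2.2.2

/-- `formalSigma V c ≠ 0`. [folklore] -/
theorem formalSigma_ne_zero (c : ℚ_[p]) : V.formalSigma c ≠ 0 := fun h => by
  have h1 := coeff_one_formalSigma V c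
  rw [h, map_zero] at h1
  exact zero_ne_one h1

/-- **Twisting a member of the family**: `formalSigma V c · exp(ε·log_V²) = formalSigma V (c − 2ε)` —
the twist is again a normalised odd solution, with constant `c − 2ε`
(`SatisfiesSigmaODE.mul_exp_subst`, `IsFormallyOdd.mul_exp_subst`), hence THE one (`eq_formalSigma`).
[Mazur–Tate 1991, §3; Mazur–Stein–Tate 2006, §3.1] [cite: MazurSteinTate2006, Thm. 1.3] -/
theorem formalSigma_mul_exp (c ε : ℚ_[p]) :
    V.formalSigma c * (exp ℚ_[p]).subst (C ε * V.formalLog ^ 2) = V.formalSigma (c - 2 * ε) := by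
  obtain ⟨h0, h1, hODE⟩ := (satisfiesSigmaODE_formalSigma V c).mul_exp_subst
    (constantCoeff_formalSigma V c) (coeff_one_formalSigma V c) ε
  exact eq_formalSigma h0 h1 ((isFormallyOdd_formalSigma V c).mul_exp_subst ε) hODE

/-- **THE SHIFT LAW.** `formalSigma V c′ = formalSigma V c · exp(((c − c′)/2)·log_V²)` for all
`c, c′ ∈ ℚ_p`: the family of normalised odd solutions of the sigma equation is a torsor under the
one-parameter group `ε ↦ exp(ε·log_V²)`; in Bernardi's / Perrin-Riou's `z = log_V(t)`:
`σ_{c′}(z) = σ_c(z)·e^{(c−c′)z²/2}`. [Mazur–Tate 1991, §3 (proof of Thm. 3.1); Mazur–Stein–Tate 2006,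
§3.1; Bernardi 1981] [cite: MazurSteinTate2006, Thm. 1.3] [cite: MazurTate1991, Thm. 3.1] -/
theorem formalSigma_eq_formalSigma_mul_exp (c c' : ℚ_[p]) :
    V.formalSigma c' = V.formalSigma c * (exp ℚ_[p]).subst (C ((c - c') / 2) * V.formalLog ^ 2) := by
  rw [formalSigma_mul_exp]
  congr 1
  ring

/-- The shift law from the reference member `c = 0`: `formalSigma V c = formalSigma V 0 · exp(−(c/2) log_V²)`.
[cite: MazurSteinTate2006, Thm. 1.3] -/
theorem formalSigma_eq_formalSigma_zero_mul_exp (c : ℚ_[p]) :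
    V.formalSigma c = V.formalSigma 0 * (exp ℚ_[p]).subst (C (-(c / 2)) * V.formalLog ^ 2) := by
  rw [formalSigma_eq_formalSigma_mul_exp V 0 c]
  congr 3
  ring

/-- **Any two normalised odd solutions differ by the exp factor**: if `σ₁, σ₂ = t + ⋯` are odd and
satisfy the sigma equation with constants `c₁, c₂`, then `σ₂ = σ₁ · exp(((c₁ − c₂)/2)·log_V²)`.
[Mazur–Tate 1991, §3; Mazur–Stein–Tate 2006, §3.1] [cite: MazurSteinTate2006, Thm. 1.3] -/
theorem eq_mul_exp_of_satisfiesSigmaODE {σ₁ σ₂ : ℚ_[p]⟦X⟧} {c₁ c₂ : ℚ_[p]}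
    (h₁0 : constantCoeff σ₁ = 0) (h₁1 : coeff 1 σ₁ = 1) (h₁odd : V.IsFormallyOdd σ₁)
    (h₁ODE : V.SatisfiesSigmaODE σ₁ c₁)
    (h₂0 : constantCoeff σ₂ = 0) (h₂1 : coeff 1 σ₂ = 1) (h₂odd : V.IsFormallyOdd σ₂)
    (h₂ODE : V.SatisfiesSigmaODE σ₂ c₂) :
    σ₂ = σ₁ * (exp ℚ_[p]).subst (C ((c₁ - c₂) / 2) * V.formalLog ^ 2) := by
  rw [eq_formalSigma h₁0 h₁1 h₁odd h₁ODE, eq_formalSigma h₂0 h₂1 h₂odd h₂ODE]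
  exact formalSigma_eq_formalSigma_mul_exp V c₁ c₂

/-- **The shift law in Perrin-Riou's parameter**: `σ_v` for the value `s₂′` of the CM constant is `σ_v`
for `s₂` times `exp(((s₂ − s₂′)/2)·log_V²)` (`perrinRiouSigma V s₂ = formalSigma V (b₂/12 + s₂)`;
Bertrand 1982: `θ(z) = σ(z)exp(−s₂z²/2)`). [Perrin-Riou 1984, Ch. III §1.2; Bertrand 1982, §2]
[cite: Perrinriou1984, Ch. III §1.2 Lemme 2] -/
theorem perrinRiouSigma_eq_mul_exp (s₂ s₂' : ℚ_[p]) :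
    V.perrinRiouSigma s₂' =
      V.perrinRiouSigma s₂ * (exp ℚ_[p]).subst (C ((s₂ - s₂') / 2) * V.formalLog ^ 2) := by
  unfold perrinRiouSigma
  rw [formalSigma_eq_formalSigma_mul_exp V (V.b₂ / 12 + s₂) (V.b₂ / 12 + s₂')]
  congr 3
  ring

/-- Perrin-Riou's family IS the whole family: `perrinRiouSigma V (c − b₂/12) = formalSigma V c`.
[cite: Perrinriou1984, Ch. III §1.2 Lemme 2] -/
theorem perrinRiouSigma_sub_eq_formalSigma (c : ℚ_[p]) :
    V.perrinRiouSigma (c - V.b₂ / 12) = V.formalSigma c := by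
  unfold perrinRiouSigma
  congr 1
  ring

/-- Mazur–Tate's `σ_p` in the family: whenever a Mazur–Tate pair exists, `σ_p · exp(((c_p − c)/2) log²)
= formalSigma V c` for every `c` (`padicSigma_eq_formalSigma`). [Mazur–Stein–Tate 2006, Thm. 1.3]
[cite: MazurSteinTate2006, Thm. 1.3] -/
theorem formalSigma_eq_padicSigma_mul_exp
    (h : ∃ σ : ℚ_[p]⟦X⟧, ∃ c : ℚ_[p], V.IsMazurTateSigmaPair σ c) (c : ℚ_[p]) :
    V.formalSigma c =
      V.padicSigma * (exp ℚ_[p]).subst (C ((V.padicSigmaConst - c) / 2) * V.formalLog ^ 2) := by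
  rw [padicSigma_eq_formalSigma h]
  exact formalSigma_eq_formalSigma_mul_exp V _ _

/-! ### §3 Low-order coefficients: `[t²]σ_c = a₁/2`, the constant is read on `[t³]` -/

/-- `[t²] formalSigma V c = a₁/2` for EVERY `c` (oddness pins `σ₂`; Mazur–Stein–Tate write
`σ = t + (a₁/2)t² + ⋯`). [Mazur–Stein–Tate 2006, Thm. 1.3, Rem. 1.4] [cite: MazurSteinTate2006, Rem. 1.4] -/
theorem coeff_two_formalSigma (c : ℚ_[p]) : coeff 2 (V.formalSigma c) = V.a₁ / 2 := by
  have h := V.two_mul_coeff_two_of_isFormallyOdd (isFormallyOdd_formalSigma V c)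
    (constantCoeff_formalSigma V c) (coeff_one_formalSigma V c)
  linear_combination h / 2

/-- Multiplying `σ = t + σ₂t² + σ₃t³ + ⋯` (`σ(0) = 0`, `[t]σ = 1`) by `E = 1 + 0·t + εt² + ⋯`:
`[t³](σE) = σ₃ + ε`. [folklore] -/
theorem coeff_three_mul_of_low_coeffs {σ E : ℚ_[p]⟦X⟧} (hσ0 : constantCoeff σ = 0) (hσ1 : coeff 1 σ = 1)
    (hE0 : constantCoeff E = 1) (hE1 : coeff 1 E = 0) {ε : ℚ_[p]} (hE2 : coeff 2 E = ε) :
    coeff 3 (σ * E) = coeff 3 σ + ε := by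
  rw [coeff_mul, Finset.Nat.sum_antidiagonal_eq_sum_range_succ_mk]
  simp [Finset.sum_range_succ, hσ0, hσ1, hE0, hE1, hE2]
  ring

/-- `[t²](σE) = [t²]σ` under the same hypotheses. [folklore] -/
theorem coeff_two_mul_of_low_coeffs {σ E : ℚ_[p]⟦X⟧} (hσ0 : constantCoeff σ = 0)
    (hE0 : constantCoeff E = 1) (hE1 : coeff 1 E = 0) :
    coeff 2 (σ * E) = coeff 2 σ := by
  rw [coeff_mul, Finset.Nat.sum_antidiagonal_eq_sum_range_succ_mk]
  simp [Finset.sum_range_succ, hσ0, hE0, hE1]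

/-- **The constant is read on the `t³`-coefficient**: `[t³] formalSigma V c′ − [t³] formalSigma V c =
(c − c′)/2`. (In `z = log_V t`: `log σ_c = log z + (b₂/24 − c/2)z² + ⋯`, the census cell's convention
note in `CensusX42Height`.) [Mazur–Stein–Tate 2006, §3.1; Mazur–Tate 1991, §3] [cite: MazurSteinTate2006, Thm. 1.3] -/
theorem coeff_three_formalSigma_sub (c c' : ℚ_[p]) :
    coeff 3 (V.formalSigma c') - coeff 3 (V.formalSigma c) = (c - c') / 2 := by
  rw [formalSigma_eq_formalSigma_mul_exp V c c',
    coeff_three_mul_of_low_coeffs (constantCoeff_formalSigma V c) (coeff_one_formalSigma V c)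
      (constantCoeff_exp_formalLog_sq V _) (coeff_one_exp_formalLog_sq V _) (coeff_two_exp_formalLog_sq V _)]
  ring

/-- `c ↦ [t³] formalSigma V c` is affine with slope `−1/2`: `[t³]σ_c = [t³]σ_0 − c/2`.
[cite: MazurSteinTate2006, Thm. 1.3] -/
theorem coeff_three_formalSigma (c : ℚ_[p]) :
    coeff 3 (V.formalSigma c) = coeff 3 (V.formalSigma 0) - c / 2 := by
  have h := coeff_three_formalSigma_sub V 0 c
  linear_combination h

/-- The constant recovered from the sigma function: `c = 2·([t³]σ_0 − [t³]σ_c)`.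
[cite: MazurSteinTate2006, Thm. 1.3] -/
theorem const_eq_of_formalSigma (c : ℚ_[p]) :
    c = 2 * (coeff 3 (V.formalSigma 0) - coeff 3 (V.formalSigma c)) := by
  have h := coeff_three_formalSigma V c
  linear_combination (2 : ℚ_[p]) * h

/-- **`c ↦ formalSigma V c` is injective**: distinct constants give distinct sigma functions (so a
`σ_c`-height datum determines its line parameter `c`). [cite: MazurSteinTate2006, Thm. 1.3] -/
theorem formalSigma_injective : Function.Injective V.formalSigma := by
  intro c c' h
  have h3 := coeff_three_formalSigma_sub V c c'
  rw [h, sub_self] at h3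
  linear_combination (-2 : ℚ_[p]) * h3

/-- `formalSigma V c = formalSigma V c′ ↔ c = c′`. [cite: MazurSteinTate2006, Thm. 1.3] -/
theorem formalSigma_eq_iff (c c' : ℚ_[p]) : V.formalSigma c = V.formalSigma c' ↔ c = c' :=
  (formalSigma_injective V).eq_iff

/-- The constant of a normalised odd solution is determined by the solution: if `σ` solves the sigma
equation with constants `c₁` and `c₂` then `c₁ = c₂`. [Mazur–Stein–Tate 2006, Rem. 1.4] [cite: MazurSteinTate2006, Rem. 1.4] -/
theorem const_unique_of_satisfiesSigmaODE {σ : ℚ_[p]⟦X⟧} {c₁ c₂ : ℚ_[p]}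
    (h0 : constantCoeff σ = 0) (h1 : coeff 1 σ = 1) (hodd : V.IsFormallyOdd σ)
    (hODE₁ : V.SatisfiesSigmaODE σ c₁) (hODE₂ : V.SatisfiesSigmaODE σ c₂) : c₁ = c₂ := by
  have e₁ := eq_formalSigma h0 h1 hodd hODE₁
  have e₂ := eq_formalSigma h0 h1 hodd hODE₂
  exact formalSigma_injective V (e₁.symm.trans e₂)

/-! ### §4 c-independence of the formal theta relation (Blakestad–Grant Prop. 14 for every member) -/

/-- **Every member of the family satisfies the formal theta relation** `σ(u +_F v)σ(u −_F v)u²v² =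
(u²X(v) − v²X(u))σ(u)²σ(v)²` in `ℚ_p⟦u,v⟧`, for `V` with `p`-integral equation and `Δ ≠ 0` — the
Mazur–Tate characterising property does not see the constant `c` (the exp factors cancel:
`log(u +_F v)² + log(u −_F v)² = 2 log(u)² + 2 log(v)²`). Consequently every `σ_c`-height obeys the same
parallelogram law / is a quadratic form on the formal group, exactly as the canonical one.
[Blakestad–Grant 2023, Prop. 14; Mazur–Tate 1991, Thm. 3.1] [cite: BlakestadGrant2023, Prop. 14] -/
theorem thetaLHS_formalSigma_eq_thetaRHS [V.IsIntegral ℤ_[p]] [V.IsElliptic] (c : ℚ_[p]) :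
    V.thetaLHS (V.formalSigma c) = V.thetaRHS (V.formalSigma c) :=
  V.thetaLHS_eq_thetaRHS (constantCoeff_formalSigma V c) (coeff_one_formalSigma V c)
    (isFormallyOdd_formalSigma V c) (satisfiesSigmaODE_formalSigma V c)

/-- The same for Perrin-Riou's `σ_v(L_v(t))` with ANY value of the parameter `s₂`.
[Blakestad–Grant 2023, Prop. 14; Perrin-Riou 1984, Ch. III §1.2 Lemme 3] [cite: BlakestadGrant2023, Prop. 14] -/
theorem thetaLHS_perrinRiouSigma_eq_thetaRHS [V.IsIntegral ℤ_[p]] [V.IsElliptic] (s₂ : ℚ_[p]) :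
    V.thetaLHS (V.perrinRiouSigma s₂) = V.thetaRHS (V.perrinRiouSigma s₂) :=
  thetaLHS_formalSigma_eq_thetaRHS V _

/-! ### §5 The log-derivative law `D σ_{c′}·σ_c − σ_{c′}·D σ_c = (c − c′)·log_V·σ_c·σ_{c′}` -/

/-- `D log_V = 1` (`log_V = ∫ω`, `D = d/ω`). [Silverman AEC IV.4–IV.5] [folklore] -/
theorem formalInvariantDerivation_formalLog : V.formalInvariantDerivation V.formalLog = 1 := by
  rw [formalInvariantDerivation_apply, derivative_formalLog, V.formalEta_mul_formalOmega]

/-- **`D exp(ε·log_V²) = 2ε·log_V·exp(ε·log_V²)`** (`D = d/ω`). [folklore] -/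
theorem formalInvariantDerivation_exp_formalLog_sq (ε : ℚ_[p]) :
    V.formalInvariantDerivation ((exp ℚ_[p]).subst (C ε * V.formalLog ^ 2)) =
      2 * C ε * V.formalLog * (exp ℚ_[p]).subst (C ε * V.formalLog ^ 2) := by
  have hg0 := constantCoeff_C_mul_formalLog_sq V ε
  have hηω : V.formalEta * V.formalOmega = 1 := V.formalEta_mul_formalOmega
  rw [formalInvariantDerivation_apply, derivative_exp_subst hg0, Derivation.leibniz, Derivation.leibniz_pow,
    derivative_C, derivative_formalLog, smul_zero, add_zero, smul_eq_mul, nsmul_eq_mul, Nat.cast_ofNat,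
    Nat.add_one_sub_one, pow_one]
  linear_combination (2 * C ε * V.formalLog * (exp ℚ_[p]).subst (C ε * V.formalLog ^ 2)) * hηω

/-- **THE LOG-DERIVATIVE LAW**: `D σ_{c′} · σ_c − σ_{c′} · D σ_c = (c − c′)·log_V·σ_c·σ_{c′}`, i.e.
`D log(σ_{c′}/σ_c) = (c − c′)·log_V` — the Wronskian of two members of the family is `(c − c′) log_V`
times their product. [Mazur–Tate 1991, §3; Mazur–Stein–Tate 2006, §3.1] [cite: MazurSteinTate2006, Thm. 1.3] -/
theorem wronskian_formalSigma (c c' : ℚ_[p]) :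
    V.formalInvariantDerivation (V.formalSigma c') * V.formalSigma c -
        V.formalSigma c' * V.formalInvariantDerivation (V.formalSigma c) =
      C (c - c') * V.formalLog * V.formalSigma c * V.formalSigma c' := by
  set E := (exp ℚ_[p]).subst (C ((c - c') / 2) * V.formalLog ^ 2) with hE
  have hσ' : V.formalSigma c' = V.formalSigma c * E := formalSigma_eq_formalSigma_mul_exp V c c'
  have hDE : V.formalInvariantDerivation E = 2 * C ((c - c') / 2) * V.formalLog * E :=
    formalInvariantDerivation_exp_formalLog_sq V _
  have hC : (2 : ℚ_[p]⟦X⟧) * C ((c - c') / 2) = C (c - c') := by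
    rw [show (2 : ℚ_[p]⟦X⟧) = C (2 : ℚ_[p]) by rw [map_ofNat], ← map_mul]
    congr 1
    ring
  rw [hσ', Derivation.leibniz, smul_eq_mul, smul_eq_mul, hDE]
  linear_combination (V.formalLog * E * V.formalSigma c * V.formalSigma c) * hC

end Summit.BirchSwinnertonDyer.BirchSwinnertonDyer.Theorems.PSSigmaLineFamily

end
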